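import Summits.BirchSwinnertonDyer.Rank1Residual.Additive.StrictSignedInvariantClasses
import Literature.NumberTheory.EllipticCurves.KummerSelmerStructure
import Literature.NumberTheory.EllipticCurves.CyclicInflation
import Literature.NumberTheory.EllipticCurves.SelmerRestrictionCorank
import HarnessLib

/-!
# Descent of the invariant zero-clause classes to `H¹(E, E[p^m])` — the cohomological half of the
# elementary B3 corank bound (cell `b2b-bsdres`, CLASS-CLOSURE lane, class O10 — x1b GEN 39, class
# lead; file 82 of the series)

HONEST FRAMING (cell `b2b-bsdres`, run/shared/lean/b2b/bsd-rank1-residual/, verbatim in every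
file): the goal of the cell is to DELETE the COMBINATION-SHAPED residual classes of the
Birch–Swinnerton-Dyer formula for ALL analytic-rank `≤ 1` elliptic curves over `ℚ` — "full BSD
formula for every rank `≤ 1` curve in class `C`" assembled STRICTLY from published theorems — so
that the rank-`≤ 1` remainder becomes exactly the CONSTRUCTION-SHAPED classes, which are TYPED
(missing-input `Prop`s), NOT attempted. This is not "finishing BSD". CLASS-CLOSURE lane: prove
what is provable now; shrink each hard class to its core with data; no claim beyond stated classes;
research routes on CONSTRUCTION-SHAPED X12 / O10; census / instrument output = EVIDENCE / conjecture
items, NEVER a Literature fact; `RESIDUAL-MAP.md` marks change only by signed lines. THIS FILE: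
TOOL THEOREMS ONLY — no definition, no named Literature fact, no `sorry`, axioms standard; nothing
is booked; no label / mark / count / sub-cell moves; (C1_η), (C2_η-GZ), (C3_η) stay typed as filed
(cc-typer-6's pen); nothing about `BSD(W, p)` of any pair is claimed.

## What

File 81 produced, in Kobayashi's zero-clause minus group `N = E⁻(K_n·E) ∩ ker Tr_{n/0}` at layer
`n` of a `ℤ_p`-extension, `p^{min(m,#S)}` points `x` with `g•x − x ∈ p^m N`, pairwise incongruent
modulo `p^m E(K_n·E)`. This file DESCENDS their Kummer classes to the bottom layer EXPLICITLY
(inflation–restriction for the cyclic quotient `Gal(K_n·E/E) = ⟨g⟩`, `E[p^m](K_n·E) = 0`), in the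
tree's continuous cohomology `H¹(Γ_E, E[p^m](K̄))` of the restricted module
(`GaloisRep.restrictField E (W.torsionGaloisModule (p^m))`, the currency of the local Kummer classes
`localKummerClass` and of the count's files 71–78):

* §1 `isCyclicQuotient_layer_of_isUnit` (`Γ_E/Gal(K̄_E/K_n·E) = ⟨g⟩` of order `p^n` for any `g`
  with `κ(g|_{K̄}) ∈ ℤ_pˣ`, file 81 §4), `smul_sPow_eq_of_pow_smul_eq`,
  **`sPow_eq_zero_of_mem_zeroClause`** (`N_g(y) = Σ_{j<p^n} g^j y = 0` on `N`: it is `g`-fixed);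
* §2 **`exists_contOneCocycles_descent`**: for `p^m R = x` and a crossed homomorphism `a` vanishing
  on an open subgroup with `p^m a(τ) = τx − x`, the map `τ ↦ θ⁻¹(τR − R − a(τ))` is a continuous
  crossed homomorphism `Γ_E → E[p^m](K̄)` (`θ` = the torsion comparison `torsionPointsEquiv`);
* §3 **`exists_finset_galoisCohomology_of_zeroClause`**: `p^{min(m,#S)}` DISTINCT classes of
  `H¹(E, E[p^m])`, each represented by a cocycle whose values on `Gal(K̄_E/K_n·E)` are `u ↦ u•R − R`
  with `p^m R` a zero-clause minus point — i.e. each restricts to the layer-`n` Kummer class of a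
  point of `N` (hence lies in the level-`m` minus condition, whatever receptacle the count adopts;
  x1b GEN 39 note §3 (iv)). The inflated part is the tree's cyclic cocycle
  `IsCyclicQuotient.exists_cocyclesVanishingOn` attached to `y = (g x − x)/p^m ∈ Ker N_g`;
  distinctness: equal classes force `R − R'` to be `K_n·E`-rational modulo `E[p^m]`, i.e.
  `x ≡ x'` modulo `p^m E(K_n·E)`. Hypotheses: `κ(g|_{K̄}) ∈ ℤ_pˣ`, no `p`-torsion in `E(K_n·E)`
  (Prop. 8.7, kernel for the lane's curves), `E(K̄_E)` `p^m`-divisible, witness layers `S`.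

With `#S ≥ m` (one witness per odd layer `≤ 2m − 1`): **`≥ p^m` distinct classes of `H¹(E, E[p^m])`
in the minus condition** — the corank-one half of [Kobayashi2003] Thm. 6.2 on the `η`-component,
WITHOUT Coleman maps. Remaining for B3 (note §3): the witnesses (Prop. 8.12 + formal logarithm),
the cyclicity `#Σ_m[p] ≤ p` from transversality + `#H¹(E, E[p]) = p²`, and the receptacle `Σ_m`.

References: [Kobayashi2003] S. Kobayashi, Invent. Math. 152 (2003), §2 p. 4, Thm. 6.2 (p. 11),
Prop. 8.7 (p. 16), Lemma 8.17 (p. 19); [GreenbergLNM1716] R. Greenberg, LNM 1716, §3 p. 86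
(inflation–restriction along the layers); [SerreGaloisCohomology1997] I.§2.6(b), I.§5.8.
-/

noncomputable section

open scoped Classical

universe u

namespace Summit.BirchSwinnertonDyer.Rank1Residual.Additive.StrictSignedCount

open Literature.NumberTheory.EllipticCurves Literature.NumberTheory.GaloisRepresentations
  Literature.NumberTheory.EllipticCurves.Kobayashi2003 ZpExtension Field WeierstrassCurve
  Literature.NumberTheory.EllipticCurves.ZpDescent
  Summit.BirchSwinnertonDyer.Rank1Residual.Additive
open scoped ContRepresentation

variable {K : Type u} [Field K] {p : ℕ} [hp : Fact p.Prime] (κ : ZpExtension K p)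
  (E : Type u) [Field E] [Algebra K E] (W : WeierstrassCurve K)

/-! ### §1 The cyclic quotient `Gal(K_n·E/E) = ⟨g⟩` and the partial norms of zero-clause points -/

/-- `Gal(K̄_E/K_n·E)` is a cyclic quotient of `Γ_E` of order `p^n` generated by any `g` with
`κ(g|_{K̄}) ∈ ℤ_pˣ` (file 81 §4). [folklore] -/
theorem isCyclicQuotient_layer_of_isUnit (g : absoluteGaloisGroup E)
    (hg : IsUnit (κ (resGalOfEmb (closureEmb (K := K) E) g)).toAdd) (n : ℕ) :
    IsCyclicQuotient (localLayerSubgroupOfEmb κ (closureEmb (K := K) E) n) g (p ^ n) where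
  pow_mem_iff := fun d => pow_mem_layer_iff_of_isUnit κ (closureEmb (K := K) E) g hg n d
  exists_pow := fun τ => by
    obtain ⟨i, u, hu, rfl⟩ := exists_eq_pow_mul_layer_of_isUnit κ (closureEmb (K := K) E) g hg n τ
    exact ⟨i, by rwa [inv_mul_cancel_left]⟩

/-- `g • S_M(y) = S_M(y)` once `g^M • y = y` (telescoping `sPow_succ`/`sPow_succ_right`). [folklore] -/
theorem smul_sPow_eq_of_pow_smul_eq {G : Type*} [Group G] {M : Type*} [AddCommGroup M]
    [DistribMulAction G M] (g : G) (y : M) (l : ℕ) (h : g ^ l • y = y) :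
    g • sPow g y l = sPow g y l := by
  have h1 : sPow g y (l + 1) = y + g • sPow g y l := sPow_succ g y l
  rw [sPow_succ_right, h] at h1
  -- h1 : sPow g y l + y = y + g • sPow g y l
  have := h1
  rw [add_comm] at this
  exact (add_left_cancel this).symm

/-- **`N_g(y) = Σ_{j<p^n} g^j y = 0` for a zero-clause minus point `y`** (it is `g`-fixed, and
`N^g = 0`, file 81 §1). [cite: Kobayashi2003, §2 p. 4] -/
theorem sPow_eq_zero_of_mem_zeroClause (g : absoluteGaloisGroup E)
    (hg : IsUnit (κ (resGalOfEmb (closureEmb (K := K) E) g)).toAdd) (n : ℕ)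
    (htors : ∀ P ∈ localLayerPointsOfEmb κ (closureEmb (K := K) E) W n, p • P = 0 → P = 0)
    {y : localPoints W E}
    (hy : y ∈ signedLocalPointsOfEmb κ (closureEmb (K := K) E) W (-1) n ⊓
      (localTraceOfEmb κ (closureEmb (K := K) E) W 0 n).ker) :
    sPow g y (p ^ n) = 0 := by
  have hyn : y ∈ localLayerPointsOfEmb κ (closureEmb (K := K) E) W n :=
    signedLocalPointsOfEmb_le κ _ W (-1) n hy.1
  refine eq_zero_of_smul_eq_of_mem_zeroClause κ (closureEmb (K := K) E) W g n
    (hgen_of_isUnit κ _ W g hg n) htors ?_ ?_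
  · unfold sPow
    exact AddSubgroup.sum_mem _ fun j _ => smul_mem_zeroClause κ _ W (g ^ j) n hy
  · exact smul_sPow_eq_of_pow_smul_eq g y (p ^ n) (pow_prime_pow_smul_of_mem κ _ W g n hyn)

/-! ### §2 The descended cocycle -/

section Descent

variable [CharZero K] [W.IsElliptic] {n : ℤ}

/-- **The descended Kummer cocycle.** For `R ∈ E(K̄_E)` with `n • R = x` and a crossed homomorphism
`a : Γ_E → E(K̄_E)` vanishing on an OPEN subgroup with `n • a(τ) = τ • x − x` for all `τ`, the map
`τ ↦ θ⁻¹(τ • R − R − a(τ))` is a continuous crossed homomorphism `Γ_E → E[n](K̄)` — the class of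
`H¹(E, E[n])` whose restriction to the vanishing subgroup is the Kummer cocycle of `R`.
[cite: Kobayashi2003, Lemma 8.17 (p. 19)] [cite: GreenbergLNM1716, §3 p. 86] -/
theorem exists_contOneCocycles_descent (hn : n ≠ 0) (U : Subgroup (absoluteGaloisGroup E))
    (hU : IsOpen (U : Set (absoluteGaloisGroup E))) (a : cocyclesVanishingOn (localPoints W E) U)
    {x R : localPoints W E} (hR : n • R = x) (ha : ∀ τ : absoluteGaloisGroup E, n • a.1 τ = τ • x - x) :
    ∃ φ : contOneCocycles
        (DiscreteGaloisModule.toTopRep (GaloisRep.restrictField E (W.torsionGaloisModule n))),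
      ∀ τ : absoluteGaloisGroup E,
        pointsMap W E ((φ.1 τ : geomTorsion W n) : geomPoints W) = τ • R - R - a.1 τ := by
  have htor : ∀ τ : absoluteGaloisGroup E, τ • R - R - a.1 τ ∈ AddSubgroup.torsionBy (localPoints W E) n := by
    intro τ
    change n • (τ • R - R - a.1 τ) = 0
    rw [zsmul_sub, zsmul_sub, ← W.smul_zsmul_localPoints n τ R, hR, ha τ, sub_self]
  refine ⟨⟨⟨fun τ => (W.torsionPointsEquiv n (E := E) hn).symm ⟨τ • R - R - a.1 τ, htor τ⟩,
    continuous_of_discreteTopology.comp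
      ((((continuous_smul_of_isOpen_stabilizer R (W.isOpen_stabilizer_localPoints E R)).sub
        continuous_const).sub (cocyclesVanishingOn.continuous_of_isOpen a hU)).subtype_mk _)⟩,
    fun g h => ?_⟩, fun τ => ?_⟩
  · change (W.torsionPointsEquiv n (E := E) hn).symm ⟨(g * h) • R - R - a.1 (g * h), _⟩ =
      (W.torsionPointsEquiv n (E := E) hn).symm ⟨g • R - R - a.1 g, _⟩ +
        absGaloisRestrict K E g • (W.torsionPointsEquiv n (E := E) hn).symm ⟨h • R - R - a.1 h, _⟩
    rw [← resGal_eq_absGaloisRestrict, ← torsionPointsEquiv_symm_smul, ← map_add]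
    congr 1
    apply Subtype.ext
    change (g * h) • R - R - a.1 (g * h) = (g • R - R - a.1 g) + g • (h • R - R - a.1 h)
    rw [mul_smul, cocyclesVanishingOn.cocycle a g h, smul_sub, smul_sub]
    abel
  · exact W.pointsMap_torsionPointsEquiv_symm n hn _

end Descent

/-! ### §3 Distinct classes of `H¹(E, E[p^m])` that are Kummer classes of zero-clause minus points at layer `n` -/

section Main

variable [CharZero K] [W.IsElliptic]

/-- **DESCENT: `p^{min(m,#S)}` DISTINCT classes of `H¹(E, E[p^m])` each restricting, on
`Gal(K̄_E/K_n·E)`, to the Kummer cocycle `u ↦ u•R − R` of a `p^m`-th root `R` of a zero-clause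
minus point `x ∈ E⁻(K_n·E) ∩ ker Tr_{n/0}`.** Hypotheses: `g ∈ Γ_E` with `κ(g|_{K̄}) ∈ ℤ_pˣ`
(generates every layer quotient), no `p`-torsion in `E(K_n·E)` (Prop. 8.7), `E(K̄_E)` divisible by
`p^m`, and witness layers `S` as in file 81. Construction: file 81's points `x` (`g x − x = p^m y`,
pairwise incongruent modulo `p^m E(K_n·E)`), the inflated cyclic cocycle `a_y` of
`Gal(K_n·E/E) = ⟨g⟩` (`N_g(y) = 0`, §1; the tree's `IsCyclicQuotient.exists_cocyclesVanishingOn`),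
and §2's cocycle `τ ↦ θ⁻¹(τR − R − a_y(τ))`; two such classes agree only if `R − R'` is
`K_n·E`-rational modulo `E[p^m]`, i.e. `x ≡ x'` modulo `p^m E(K_n·E)`. This is the cohomological
half of the elementary B3 corank bound `#C⁻[p^m] ≥ p^m` (inflation–restriction made explicit).
[cite: Kobayashi2003, Thm. 6.2 (p. 11), Prop. 8.7 (p. 16), Lemma 8.17 (p. 19)]
[cite: GreenbergLNM1716, §3 p. 86] -/
theorem exists_finset_galoisCohomology_of_zeroClause (g : absoluteGaloisGroup E)
    (hg : IsUnit (κ (resGalOfEmb (closureEmb (K := K) E) g)).toAdd) (n m : ℕ)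
    (htors : ∀ P ∈ localLayerPointsOfEmb κ (closureEmb (K := K) E) W n, p • P = 0 → P = 0)
    (hdiv : ∀ P : localPoints W E, ∃ R : localPoints W E, ((p ^ m : ℕ) : ℤ) • R = P)
    (S : Finset ℕ) (hS0 : 0 ∉ S) (hSn : ∀ k ∈ S, k ≤ n)
    (hwit : ∀ k ∈ S, ∃ w ∈ signedLocalPointsOfEmb κ (closureEmb (K := K) E) W (-1) k ⊓
        (localTraceOfEmb κ (closureEmb (K := K) E) W 0 k).ker,
      ¬ ∃ a ∈ localLayerPointsOfEmb κ (closureEmb (K := K) E) W k,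
        ∃ b ∈ localLayerPointsOfEmb κ (closureEmb (K := K) E) W (k - 1), w = p • a + b) :
    ∃ Ξ : Finset (galoisCohomology
        (GaloisRep.restrictField E (W.torsionGaloisModule ((p ^ m : ℕ) : ℤ))) 1),
      Ξ.card = p ^ min m S.card ∧
      ∀ ξ ∈ Ξ, ∃ x ∈ signedLocalPointsOfEmb κ (closureEmb (K := K) E) W (-1) n ⊓
          (localTraceOfEmb κ (closureEmb (K := K) E) W 0 n).ker,
        ∃ R : localPoints W E, ((p ^ m : ℕ) : ℤ) • R = x ∧
        ∃ φ : contOneCocycles (DiscreteGaloisModule.toTopRep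
            (GaloisRep.restrictField E (W.torsionGaloisModule ((p ^ m : ℕ) : ℤ)))),
          oneCocycleClass _ φ = ξ ∧
          ∀ u ∈ localLayerSubgroupOfEmb κ (closureEmb (K := K) E) n,
            pointsMap W E ((φ.1 u : geomTorsion W ((p ^ m : ℕ) : ℤ)) : geomPoints W) = u • R - R := by
  set ι := closureEmb (K := K) E with hι
  set nn : ℤ := ((p ^ m : ℕ) : ℤ) with hnn
  have hnn0 : nn ≠ 0 := by
    rw [hnn]; exact_mod_cast pow_ne_zero m hp.out.ne_zero
  set U := localLayerSubgroupOfEmb κ ι n with hU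
  haveI hUn : U.Normal := normal_localSubgroupOfEmb ι (κ.layerSubgroup n)
  have hUopen : IsOpen (U : Set (absoluteGaloisGroup E)) :=
    isOpen_localSubgroupOfEmb (κ.layerSubgroup n) ι (κ.isOpen_layerSubgroup n)
  have hcyc : IsCyclicQuotient U g (p ^ n) := isCyclicQuotient_layer_of_isUnit κ E g hg n
  set N := signedLocalPointsOfEmb κ ι W (-1) n ⊓ (localTraceOfEmb κ ι W 0 n).ker with hN
  -- the points of file 81
  obtain ⟨X, hXcard, hXN, hXdist⟩ := exists_finset_zeroClause_invariant_mod_pow_layer κ ι W g n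
    (hgen_of_isUnit κ ι W g hg n) htors S hS0 hSn hwit m
  -- for each point: root, inflated cocycle, descended cocycle
  have hdata : ∀ x : X, ∃ R : localPoints W E, nn • R = (x : localPoints W E) ∧
      ∃ φ : contOneCocycles (DiscreteGaloisModule.toTopRep
          (GaloisRep.restrictField E (W.torsionGaloisModule nn))),
        ∀ u ∈ U, pointsMap W E ((φ.1 u : geomTorsion W nn) : geomPoints W) = u • R - R := by
    rintro ⟨x, hx⟩
    obtain ⟨hxN, y, hyN, hxy⟩ := hXN x hx
    have hxn : x ∈ localLayerPointsOfEmb κ ι W n := signedLocalPointsOfEmb_le κ ι W (-1) n hxN.1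
    have hyn : y ∈ localLayerPointsOfEmb κ ι W n := signedLocalPointsOfEmb_le κ ι W (-1) n hyN.1
    obtain ⟨R, hR⟩ := hdiv x
    obtain ⟨a, ha⟩ := hcyc.exists_cocyclesVanishingOn (M := localPoints W E) (P := y)
      (fun u hu => (mem_localLayerPointsOfEmb_iff κ ι W n y).mp hyn u hu)
      (sPow_eq_zero_of_mem_zeroClause κ E W g hg n htors hyN)
    have ha' : ∀ τ : absoluteGaloisGroup E, nn • a.1 τ = τ • x - x := by
      intro τ
      obtain ⟨i, hi⟩ := hcyc.exists_pow τ
      rw [ha τ i hi, hnn, natCast_zsmul, ← sPow_nsmul, ← hxy, sPow_smul_sub]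
      have hτ : τ = g ^ i * ((g ^ i)⁻¹ * τ) := by rw [mul_inv_cancel_left]
      conv_rhs => rw [hτ, mul_smul, (mem_localLayerPointsOfEmb_iff κ ι W n x).mp hxn _ hi]
    obtain ⟨φ, hφ⟩ := exists_contOneCocycles_descent E W hnn0 U hUopen a hR ha'
    refine ⟨R, hR, φ, fun u hu => ?_⟩
    rw [hφ u, cocyclesVanishingOn.apply_of_mem a hu, sub_zero]
  choose Rf hRf φf hφf using hdata
  -- the classes
  let ξf : X → galoisCohomology (GaloisRep.restrictField E (W.torsionGaloisModule nn)) 1 :=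
    fun x => oneCocycleClass _ (φf x)
  -- injectivity
  have hinj : Function.Injective ξf := by
    intro x x' hxx
    have h0 : oneCocycleClass _ (φf x - φf x') = 0 := by
      rw [oneCocycleClass_sub]; exact sub_eq_zero.mpr hxx
    obtain ⟨v, hv⟩ := (oneCocycleClass_eq_zero_iff _ _).mp h0
    set T : localPoints W E := pointsMap W E ((v : geomTorsion W nn) : geomPoints W) with hT
    have hTtor : nn • T = 0 := by
      rw [hT, ← map_zsmul]
      have : nn • ((v : geomTorsion W nn) : geomPoints W) = 0 := v.2
      rw [this, map_zero]
    -- evaluate at `u ∈ U`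
    have hfix : ∀ u ∈ U, u • (Rf x - Rf x' - T) = Rf x - Rf x' - T := by
      intro u hu
      have h1 := congrArg (fun z : geomTorsion W nn => pointsMap W E (z : geomPoints W)) (hv u)
      simp only at h1
      have hl : pointsMap W E (((φf x - φf x').1 u : geomTorsion W nn) : geomPoints W) =
          (u • Rf x - Rf x) - (u • Rf x' - Rf x') := by
        rw [← hφf x u hu, ← hφf x' u hu, ← map_sub]
        rfl
      have hr : pointsMap W E ((((DiscreteGaloisModule.toTopRep
          (GaloisRep.restrictField E (W.torsionGaloisModule nn))).ρ u v - v : geomTorsion W nn)) :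
            geomPoints W) = u • T - T := by
        change pointsMap W E (((absGaloisRestrict K E u • v - v : geomTorsion W nn)) : geomPoints W) = _
        rw [← resGal_eq_absGaloisRestrict, AddSubgroup.coe_sub, map_sub, hT]
        congr 1
        exact pointsMap_smul W E u _
      rw [hl, hr] at h1
      rw [smul_sub, smul_sub]
      linear_combination (norm := abel_nf) h1
    have hDmem : Rf x - Rf x' - T ∈ localLayerPointsOfEmb κ ι W n :=
      (mem_localLayerPointsOfEmb_iff κ ι W n _).mpr hfix
    have hD : (x : localPoints W E) - x' = p ^ m • (Rf x - Rf x' - T) := by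
      rw [← natCast_zsmul, ← hnn, zsmul_sub, zsmul_sub, hRf x, hRf x', hTtor, sub_zero]
    exact Subtype.ext (hXdist x x.2 x' x'.2 ⟨_, hDmem, hD⟩)
  refine ⟨Finset.univ.image ξf, ?_, fun ξ hξ => ?_⟩
  · rw [Finset.card_image_of_injective _ hinj, Finset.card_univ, Fintype.card_coe, hXcard]
  · obtain ⟨x, -, rfl⟩ := Finset.mem_image.mp hξ
    exact ⟨x, (hXN x x.2).1, Rf x, hRf x, φf x, rfl, hφf x⟩


omit [CharZero K] in
/-- `E(K̄_E)` is `n`-divisible for `n ≠ 0` (the tree's `zsmul_surjective_of_isAlgClosed` — AEC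
III.4.2(a) + II.2.3 — on `W/K̄_E`): the `hdiv` hypothesis above, discharged.
[cite: SilvermanAEC2009, Prop. III.4.2(a), Thm. II.2.3] -/
theorem exists_zsmul_eq_localPoints {n : ℤ} (hn : n ≠ 0) (P : localPoints W E) :
    ∃ R : localPoints W E, n • R = P :=
  (W.baseChange (AlgebraicClosure E)).zsmul_surjective_of_isAlgClosed hn P

/-- `exists_finset_galoisCohomology_of_zeroClause` with the divisibility of `E(K̄_E)` discharged.
[cite: Kobayashi2003, Thm. 6.2 (p. 11), Prop. 8.7 (p. 16), Lemma 8.17 (p. 19)] -/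
theorem exists_finset_galoisCohomology_of_zeroClause' (g : absoluteGaloisGroup E)
    (hg : IsUnit (κ (resGalOfEmb (closureEmb (K := K) E) g)).toAdd) (n m : ℕ)
    (htors : ∀ P ∈ localLayerPointsOfEmb κ (closureEmb (K := K) E) W n, p • P = 0 → P = 0)
    (S : Finset ℕ) (hS0 : 0 ∉ S) (hSn : ∀ k ∈ S, k ≤ n)
    (hwit : ∀ k ∈ S, ∃ w ∈ signedLocalPointsOfEmb κ (closureEmb (K := K) E) W (-1) k ⊓
        (localTraceOfEmb κ (closureEmb (K := K) E) W 0 k).ker,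
      ¬ ∃ a ∈ localLayerPointsOfEmb κ (closureEmb (K := K) E) W k,
        ∃ b ∈ localLayerPointsOfEmb κ (closureEmb (K := K) E) W (k - 1), w = p • a + b) :
    ∃ Ξ : Finset (galoisCohomology
        (GaloisRep.restrictField E (W.torsionGaloisModule ((p ^ m : ℕ) : ℤ))) 1),
      Ξ.card = p ^ min m S.card ∧
      ∀ ξ ∈ Ξ, ∃ x ∈ signedLocalPointsOfEmb κ (closureEmb (K := K) E) W (-1) n ⊓
          (localTraceOfEmb κ (closureEmb (K := K) E) W 0 n).ker,
        ∃ R : localPoints W E, ((p ^ m : ℕ) : ℤ) • R = x ∧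
        ∃ φ : contOneCocycles (DiscreteGaloisModule.toTopRep
            (GaloisRep.restrictField E (W.torsionGaloisModule ((p ^ m : ℕ) : ℤ)))),
          oneCocycleClass _ φ = ξ ∧
          ∀ u ∈ localLayerSubgroupOfEmb κ (closureEmb (K := K) E) n,
            pointsMap W E ((φ.1 u : geomTorsion W ((p ^ m : ℕ) : ℤ)) : geomPoints W) = u • R - R :=
  exists_finset_galoisCohomology_of_zeroClause κ E W g hg n m htors
    (exists_zsmul_eq_localPoints E W (by exact_mod_cast pow_ne_zero m hp.out.ne_zero)) S hS0 hSn hwit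

end Main

end Summit.BirchSwinnertonDyer.Rank1Residual.Additive.StrictSignedCount

end
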